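import Summits.BirchSwinnertonDyer.BirchSwinnertonDyer.Theorems.RamifiedHeegnerPairLeafRankOneUpperAtThreeTwistUnit
import HarnessLib


-- D-0017: single-problem summit, so `Summit.BirchSwinnertonDyer.BirchSwinnertonDyer.…` repeats a namespace BY DESIGN.
set_option linter.dupNamespace false
set_option autoImplicit false

noncomputable section

open scoped Classical NumberField


/-! BC3 skeleton **v7 DRAFT — NOT REGISTERED** (lead prover bsd-line-rhp-p2 g7, 2026-08-28) for the crux `LeafRankOneUpperAtThree` (U₁,
stmt-BirchSwinnertonDyer-26022; route `RamifiedHeegnerPair` rev 14), line `splitkolyvagin` — the TWIST-UNIT variant.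

The registered skeleton of record is v6 (b580e6608b612f1f: PUB⁺ 27491 / S2 27492 / Σ★″ 27493 / L₀ 26023 by name). This draft replaces the
fourth stub L₀ by TU₁ (the twist-unit supply on the rank-one leaf, `SchneiderFree.Upper.TwistUnitFieldAt` by name) and composes through
p630223's `leafRankOneUpperAtThree_of_pubManin_of_divisibilityReading_of_sigmaStar_of_twistUnit`. It exists ONLY for the pen's pre-staged
option (route pen pss3 g20, 11:56:31Z / 12:06:38Z): it is to be registered by a U-lead IF AND ONLY IF the director rules that a research item
with surplus over the leaf may enter the family; until then v6 stands (both leads' word (a)). BSD is not proved; U₁ is open. -/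

namespace Summit.BirchSwinnertonDyer.BirchSwinnertonDyer.Cruxes.LeafRankOneUpperAtThree.SplitKolyvaginTU

open WeierstrassCurve Literature Literature.NumberTheory.EllipticCurves
  Summit.BirchSwinnertonDyer.BirchSwinnertonDyer.Theses.RamifiedHeegnerPair
  Summit.BirchSwinnertonDyer.BirchSwinnertonDyer.Theorems

/-! ## The stubs -/

/-- STUB PUB⁺ = route item 27491 BY NAME (PRINT, never progress). [cite: GrossZagier1986, Thm. I.(6.3) and (7.3)] [cite: MatarNekovar2019, Thm. 0.7 (p. 456)] -/
theorem stub_publishedInputsU1Manin :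
    Summit.BirchSwinnertonDyer.BirchSwinnertonDyer.Theses.RamifiedHeegnerPair.LeafRankOnePrintedInputsAtThree := by
  sorry

/-- STUB S2 = route item 27492 BY NAME (READING-GRADE, shared with potss 20165). [cite: Jetchev2008, Thm. 1.4, Cor. 1.5 (p. 812)] -/
theorem stub_jetchevDivisibilityReadingS2 :
    Summit.BirchSwinnertonDyer.BirchSwinnertonDyer.Theses.RamifiedHeegnerPair.JetchevDivisibilityReadingS2 := by
  sorry

/-- STUB Σ★″ = route item 27493 BY NAME (RESEARCH RESIDUE, orientation-free, shared with U₀'s line). [cite: Jetchev2008, Conj. 1.3 (p. 812)] -/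
theorem stub_leafSigmaStarDivisibilityAtThreeOptimalOffRows :
    Summit.BirchSwinnertonDyer.BirchSwinnertonDyer.Theses.RamifiedHeegnerPair.LeafSigmaStarDivisibilityAtThreeOptimalOffRows := by
  sorry

/-- STUB TU₁ (NEW, RESEARCH, surplus over the leaf): the twist-unit supply on the rank-one leaf — every non-CM leaf curve of analytic rank one
carries the SchneiderFree door's split twist-unit datum at `p = 3` (a Heegner field whose rank-zero twist has `3`-unit analytic `Ш`, at some member).
Gss2 rank-one twin of route `SchneiderFreeAdditiveX3Upper`'s crux `TwistUnitX3OffSliver` (20364). Per class an exact modular-symbol certificate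
(p632827 `twistUnitFieldAt_three_of_padicValRat_le`). Not print at an additive 3. [cite: KrizLi2019, Thm. 1.20] [cite: OnoSkinner1998, Cor. 2 (p. 652)] -/
theorem stub_twistUnitSupplyRankOne :
    ∀ (W : WeierstrassCurve ℚ) [W.IsElliptic] [W.IsGloballyMinimal], ¬ W.HasCM →
      Literature.NumberTheory.EllipticCurves.Rank1Residual.Addv W 3 →
      Summit.BirchSwinnertonDyer.Rank1Residual.Additive.SubGss W 3 → W.analyticRank = 1 →
      Summit.BirchSwinnertonDyer.BirchSwinnertonDyer.Theorems.SchneiderFree.Upper.TwistUnitFieldAt W 3 := by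
  sorry

/-! ## The composition -/

/-- **The crux from the stubs, BY NAME**: PUB⁺ → S2 → Σ★″ → TU₁ → `LeafRankOneUpperAtThree` (type literally the route decl), by p630223.
[cite: Jetchev2008, Conj. 1.3, Thm. 1.4 (p. 812)] [cite: MatarNekovar2019, Thm. 0.7 (p. 456)] [cite: MilneADT2006, Thm. I.7.3] [cite: Miller2011LMS, Def. 1.1] -/
theorem LeafRankOneUpperAtThree_of
    (hpub : Summit.BirchSwinnertonDyer.BirchSwinnertonDyer.Theses.RamifiedHeegnerPair.LeafRankOnePrintedInputsAtThree)
    (hD : Summit.BirchSwinnertonDyer.BirchSwinnertonDyer.Theses.RamifiedHeegnerPair.JetchevDivisibilityReadingS2)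
    (hStar : Summit.BirchSwinnertonDyer.BirchSwinnertonDyer.Theses.RamifiedHeegnerPair.LeafSigmaStarDivisibilityAtThreeOptimalOffRows)
    (hTU : ∀ (W : WeierstrassCurve ℚ) [W.IsElliptic] [W.IsGloballyMinimal], ¬ W.HasCM →
      Literature.NumberTheory.EllipticCurves.Rank1Residual.Addv W 3 →
      Summit.BirchSwinnertonDyer.Rank1Residual.Additive.SubGss W 3 → W.analyticRank = 1 →
      Summit.BirchSwinnertonDyer.BirchSwinnertonDyer.Theorems.SchneiderFree.Upper.TwistUnitFieldAt W 3) :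
    Summit.BirchSwinnertonDyer.BirchSwinnertonDyer.Theses.RamifiedHeegnerPair.LeafRankOneUpperAtThree :=
  RamifiedPairUpperBound.leafRankOneUpperAtThree_of_pubManin_of_divisibilityReading_of_sigmaStar_of_twistUnit hpub hD hStar hTU

/-- The crux from the (sorried) stubs — shows the skeleton is complete. -/
theorem LeafRankOneUpperAtThree_holds_of_stubs :
    Summit.BirchSwinnertonDyer.BirchSwinnertonDyer.Theses.RamifiedHeegnerPair.LeafRankOneUpperAtThree :=
  LeafRankOneUpperAtThree_of stub_publishedInputsU1Manin stub_jetchevDivisibilityReadingS2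
    stub_leafSigmaStarDivisibilityAtThreeOptimalOffRows stub_twistUnitSupplyRankOne

end Summit.BirchSwinnertonDyer.BirchSwinnertonDyer.Cruxes.LeafRankOneUpperAtThree.SplitKolyvaginTU

end
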